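import Summits.CriticalPhenomena.PercolationContinuityZ3.Theorems.PercNearOneGluingNoHeavyLowerTailCSHUnfoldOneTools
import HarnessLib

/-!
# `NoHeavyLowerTail` (stmt-CriticalPhenomena-4575) — the conditioned slack hierarchy CSH: Lemma U for one decoy
# (world-wise H/R̃ unfolding of the within-covariance of the level-1 form)

Support file (`--supports stmt-CriticalPhenomena-4575`), prover `prim-hp-8` (gen 10).  No named facts, no sorries; standard
axioms.  Piece P5 (k = 1), part 2 (main identity), of `prim-hp-8/SOCKET-CSH-LEAN.md` for the memo `prim-hp-8/PROOF-S5-ALL-R.md` §3.3.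

Setting (sum level, `BHK2006.weight`): owner `x`, avoided set `Y`, ONE decoy `d`, observers `o, v` (all distinct), a functional `g`
of the open edge cluster of `x`; worlds = "delete the pairs meeting `Y ∪ V(C_Y(ω))`" (`HullPort.cut Y ω`); `D = {x ↮ Y}`,
`E = {d ↮ {x} ∪ Y}`.  For ARBITRARY real parameters `a, b_o, b_v, α, β` (in the application `a = μ(E)`, `b_u = μ(E, d↔u)`,
`α = μ(v↮{x,d}∪Y)`, `β = μ(v↮{x,d}∪Y, o↔v)`) put
`h = α·(a·1{x↔o} − b_o·1{x↔d}) − β·(a·1{x↔v} − b_v·1{x↔d})` (the polynomialised level-1 form).  LEMMA U (k = 1):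

  `Σ_ω w 1_D(ω) Cov_{world(ω)}(g(C_x), h)
     = a·Σ_ω w 1_D(ω) [α·Cov_{world}(g(C_x), 1{o ↔ {x,d}}) − β·Cov_{world}(g(C_x), 1{v ↔ {x,d}})]        (H-part)
       + α·(a·P_o − b_o·P) − β·(a·P_v − b_v·P),                                                      (R̃-part)`
  `P_u = Σ_ζ w 1_E(ζ) 1{d↔u}(ζ) Φ(C_d(ζ))`, `P = Σ_ζ w 1_E(ζ) Φ(C_d(ζ))`, `Φ(K) = Σ_η w I_K(η)` (Lemma Φ's functional).

Ingredients: the pointwise split `a·1{x↔u} − b_u·1{x↔d} = a·1{u↔{x,d}} − b_u − 1{d↮x}(a·1{d↔u} − b_u)`; the Markov property at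
`C_Y` (`HullPort.set_sum_cond_sdiff`) to merge the world double sum, the vanishing of the `C_Y`-measurable term against the residual
`g − ḡ`; the Markov property at `C_d` and Lemma Φ(a) (`CSH.sum_phiIntegrand_eq`).  With `CovTau.markerDominanceAvoid` (R̃-part ≥ 0, `Φ`
monotone by `CSH.phiFun_mono`) and the set-4PT + (Htw) for the H-part this gives the k = 1 cell of CSH (assembled separately).
[cite: VandenbergHaggstromKahn2005, §2.1 Lemma 2.4 (p. 10); §1 display (10) (pp. 7–8) — corollaries]
-/

noncomputable section

namespace Summit.CriticalPhenomena.PercolationContinuityZ3.Theorems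

open MeasureTheory Set Literature.Probability.LatticeModels Literature.Probability.Percolation
open scoped Classical
open BHK2006 DecisionTree HullPort

namespace CSH

variable {V : Type*} [Fintype V]

/-! ### Step D: the Markov property at the cluster of the decoy, and Lemma Φ(a) -/

/-- **Markov at `C_d`, then Lemma Φ(a)**: for any function `ψ` of the open edge cluster of `d`,
`Σ_ζ w 1_E(ζ) ψ(C_d ζ) Θ(ζ) = − Σ_ζ w 1_E(ζ) ψ(C_d ζ) Φ(C_d(ζ))`, where `E = {d ↮ {x} ∪ Y}`,
`Θ = 1_D·(g(C_x) − ḡ)` is the telescoping residual and `Φ(K) = Σ_η w I_K(η)` (`C_d(ζ)` the vertex cluster).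
(transcription of the cell memo prim-hp-8 PROOF-S5-ALL-R.md §3.3) [folklore] -/
theorem markov_at_decoy (w : Sym2 V → ℝ) (hm : ∑ ω, weight w ω = 1) (x d : V) (Y : Set V)
    (g : Set (Sym2 V) → ℝ) (ψ : Set (Sym2 V) → ℝ) :
    ∑ ζ, weight w ζ * (ind (avoidEv d (insert x Y)) ζ * (ψ (openEdgeCluster ζ d) *
      (ind (avoidEv x Y) ζ * (g (openEdgeCluster ζ x) - wmeanOff w Y (fun β => g (openEdgeCluster β x)) ζ)))) =
      - ∑ ζ, weight w ζ * (ind (avoidEv d (insert x Y)) ζ * (ψ (openEdgeCluster ζ d) *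
        ∑ η, weight w η * phiIntegrand x Y (openCluster ζ d) g η)) := by
  classical
  -- the residual as a function of the configuration
  set Θ : Set (Sym2 V) → ℝ := fun β =>
    ind (avoidEv x Y) β * (g (openEdgeCluster β x) - wmeanOff w Y (fun β' => g (openEdgeCluster β' x)) β) with hΘ
  -- (i) on `E`, the residual does not see the deletion of the cut of `{d}`
  have hinv : ∀ ζ ∈ avoidEv d (insert x Y), Θ (ζ \ cut {d} ζ) = Θ ζ := by
    intro ζ hζ
    have hζx : ¬ (openGraph ζ).Reachable d x := hζ x (mem_insert x Y)
    have hζY : ζ ∈ avoidEv d Y := fun y hy => hζ y (mem_insert_of_mem x hy)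
    have hD : (ζ \ cut {d} ζ ∈ avoidEv x Y) ↔ (ζ ∈ avoidEv x Y) := by
      simp only [avoidEv, mem_setOf_eq, reachable_sdiff_cut_singleton_iff hζx]
    have hmean : wmeanOff w Y (fun β' => g (openEdgeCluster β' x)) (ζ \ cut {d} ζ) =
        wmeanOff w Y (fun β' => g (openEdgeCluster β' x)) ζ := by
      unfold wmeanOff; rw [cut_sdiff_cut_singleton_of_avoid hζY]
    simp only [hΘ, openEdgeCluster_sdiff_cut_singleton hζx, hmean]
    by_cases hDζ : ζ ∈ avoidEv x Y
    · rw [ind_of_mem hDζ, ind_of_mem (hD.2 hDζ)]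
    · rw [ind_of_not_mem hDζ, ind_of_not_mem (fun h => hDζ (hD.1 h))]
  -- `1_E` read off `C_d`
  have hE : ∀ ζ : Set (Sym2 V), ind (avoidEv d (insert x Y)) ζ =
      (if (∀ a ∈ insert x Y, ¬ (a ∈ ({d} : Set V) ∨ ∃ e ∈ setCl ζ {d}, a ∈ e)) then 1 else 0) := by
    intro ζ
    have hiff : ζ ∈ avoidEv d (insert x Y) ↔ ∀ a ∈ insert x Y, ¬ (a ∈ ({d} : Set V) ∨ ∃ e ∈ setCl ζ {d}, a ∈ e) := by
      simp only [avoidEv, mem_setOf_eq, reachable_iff_setCl_singleton]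
    by_cases h : ζ ∈ avoidEv d (insert x Y)
    · rw [ind_of_mem h, if_pos (hiff.1 h)]
    · rw [ind_of_not_mem h, if_neg (fun h' => h (hiff.2 h'))]
  -- kernel for the Markov property at `{d}`
  set K : Set (Sym2 V) → Set (Sym2 V) → ℝ := fun Wd β =>
    (if (∀ a ∈ insert x Y, ¬ (a ∈ ({d} : Set V) ∨ ∃ e ∈ Wd, a ∈ e)) then 1 else 0) * ψ Wd * Θ β with hK
  have key := set_sum_cond_sdiff w hm {d} K
  have hL : ∀ ζ, weight w ζ * K (setCl ζ {d}) (ζ \ barOf {d} (setCl ζ {d})) =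
      weight w ζ * (ind (avoidEv d (insert x Y)) ζ * (ψ (openEdgeCluster ζ d) * Θ ζ)) := by
    intro ζ
    simp only [hK]
    rw [← cut_eq_barOf, hE, setCl_singleton]
    by_cases h : ζ ∈ avoidEv d (insert x Y)
    · rw [hinv ζ h]; ring
    · have : (if (∀ a ∈ insert x Y, ¬ (a ∈ ({d} : Set V) ∨ ∃ e ∈ setCl ζ {d}, a ∈ e)) then (1 : ℝ) else 0) = 0 := by
        rw [← hE, ind_of_not_mem h]
      rw [setCl_singleton] at this
      rw [this]; ring
  have hR : ∀ ω, weight w ω * ∑ η, weight w η * K (setCl ω {d}) (η \ barOf {d} (setCl ω {d})) =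
      weight w ω * (ind (avoidEv d (insert x Y)) ω * (ψ (openEdgeCluster ω d) *
        -∑ η, weight w η * phiIntegrand x Y (openCluster ω d) g η)) := by
    intro ω
    have hphi : ∑ η, weight w η * phiIntegrand x Y (openCluster ω d) g η =
        -∑ η, weight w η * Θ (η \ edgesOf (openCluster ω d)) := by
      rw [sum_phiIntegrand_eq w hm, ← Finset.sum_neg_distrib]
      exact Finset.sum_congr rfl fun η _ => by simp only [hΘ]; ring
    rw [hphi, neg_neg, ← cut_eq_barOf, cut_singleton_eq_edgesOf, hE, setCl_singleton]
    congr 1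
    have e : ∀ η, weight w η * K (openEdgeCluster ω d) (η \ edgesOf (openCluster ω d)) =
        ((if (∀ a ∈ insert x Y, ¬ (a ∈ ({d} : Set V) ∨ ∃ e ∈ openEdgeCluster ω d, a ∈ e)) then (1 : ℝ) else 0) *
          ψ (openEdgeCluster ω d)) * (weight w η * Θ (η \ edgesOf (openCluster ω d))) := by
      intro η; simp only [hK]; ring
    rw [Finset.sum_congr rfl (fun η _ => e η), ← Finset.mul_sum, mul_assoc]
  calc _ = ∑ ζ, weight w ζ * K (setCl ζ {d}) (ζ \ barOf {d} (setCl ζ {d})) :=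
        Finset.sum_congr rfl fun ζ _ => (hL ζ).symm
    _ = _ := key
    _ = ∑ ω, weight w ω * (ind (avoidEv d (insert x Y)) ω * (ψ (openEdgeCluster ω d) *
        -∑ η, weight w η * phiIntegrand x Y (openCluster ω d) g η)) := Finset.sum_congr rfl fun ω _ => hR ω
    _ = _ := by rw [← Finset.sum_neg_distrib]; exact Finset.sum_congr rfl fun ω _ => by ring

/-! ### Lemma U for one decoy -/

/-- **The R̃-term of the unfolding**: for `u ≠ d`, `x ≠ d`,
`Σ_ω w 1_D(ω) Cov_{world(ω)}(g(C_x), 1{d↮x}(a·1{d↔u} − b)) = −(a·P_u − b·P)`. (transcription of the cell memo prim-hp-8 PROOF-S5-ALL-R.md §3.3) [folklore] -/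
theorem rtilde_term (w : Sym2 V → ℝ) (hm : ∑ ω, weight w ω = 1) (x d u : V) (hdx : d ≠ x) (hdu : u ≠ d) (Y : Set V)
    (g : Set (Sym2 V) → ℝ) (a b : ℝ) :
    ∑ ω, weight w ω * (ind (avoidEv x Y) ω * wcovOff w Y (fun β => g (openEdgeCluster β x))
        (fun ζ => ind (avoidEv d {x}) ζ * (a * ind (openConn d u : Set (BondConfig V)) ζ - b)) ω) =
      -(a * ∑ ζ, weight w ζ * (ind (avoidEv d (insert x Y)) ζ * (ind (openConn d u : Set (BondConfig V)) ζ *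
          ∑ η, weight w η * phiIntegrand x Y (openCluster ζ d) g η)) -
        b * ∑ ζ, weight w ζ * (ind (avoidEv d (insert x Y)) ζ *
          ∑ η, weight w η * phiIntegrand x Y (openCluster ζ d) g η)) := by
  classical
  -- Step B + C: expand the world covariance and merge the double sum at `C_Y`
  have h1 : ∑ ω, weight w ω * (ind (avoidEv x Y) ω * wcovOff w Y (fun β => g (openEdgeCluster β x))
        (fun ζ => ind (avoidEv d {x}) ζ * (a * ind (openConn d u : Set (BondConfig V)) ζ - b)) ω) =
      ∑ ζ, weight w ζ * (ind (avoidEv x Y) ζ * ((g (openEdgeCluster ζ x) -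
        wmeanOff w Y (fun β => g (openEdgeCluster β x)) ζ) *
        (ind (avoidEv d {x}) (ζ \ cut Y ζ) * (a * ind (openConn d u : Set (BondConfig V)) (ζ \ cut Y ζ) - b)))) := by
    rw [← markov_merge_Y w hm x Y g (fun ζ => ind (avoidEv d {x}) ζ * (a * ind (openConn d u : Set (BondConfig V)) ζ - b))]
    exact Finset.sum_congr rfl fun ω _ => by rw [wcovOff_eq_sum w]
  -- the world value of the test function: on `{d ↮ Y}` it is the `G`-value, otherwise `d` is isolated and it is `-b`
  have h2 : ∀ ζ : Set (Sym2 V),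
      ind (avoidEv d {x}) (ζ \ cut Y ζ) * (a * ind (openConn d u : Set (BondConfig V)) (ζ \ cut Y ζ) - b) =
      ind (avoidEv d Y) ζ * (ind (avoidEv d {x}) ζ * (a * ind (openConn d u : Set (BondConfig V)) ζ - b)) +
        (1 - ind (avoidEv d Y) ζ) * (-b) := by
    intro ζ
    by_cases hζ : ζ ∈ avoidEv d Y
    · rw [ind_of_mem hζ]
      have hA : ((ζ \ cut Y ζ) ∈ avoidEv d {x}) ↔ (ζ ∈ avoidEv d {x}) := by
        simp only [avoidEv, mem_setOf_eq, reachable_sdiff_cut_iff_of_avoid hζ]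
      have hC : ((ζ \ cut Y ζ) ∈ (openConn d u : Set (BondConfig V))) ↔ (ζ ∈ (openConn d u : Set (BondConfig V))) :=
        reachable_sdiff_cut_iff_of_avoid hζ u
      have e1 : ind (avoidEv d {x}) (ζ \ cut Y ζ) = ind (avoidEv d {x}) ζ := by
        by_cases h : ζ ∈ avoidEv d {x}
        · rw [ind_of_mem h, ind_of_mem (hA.2 h)]
        · rw [ind_of_not_mem h, ind_of_not_mem (fun h' => h (hA.1 h'))]
      have e2 : ind (openConn d u : Set (BondConfig V)) (ζ \ cut Y ζ) = ind (openConn d u : Set (BondConfig V)) ζ := by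
        by_cases h : ζ ∈ (openConn d u : Set (BondConfig V))
        · rw [ind_of_mem h, ind_of_mem (hC.2 h)]
        · rw [ind_of_not_mem h, ind_of_not_mem (fun h' => h (hC.1 h'))]
      rw [e1, e2]; ring
    · rw [ind_of_not_mem hζ]
      have e1 : ind (avoidEv d {x}) (ζ \ cut Y ζ) = 1 :=
        ind_of_mem fun t ht h => by
          rw [mem_singleton_iff] at ht; subst ht
          exact hdx (eq_of_reachable_sdiff_cut hζ ζ t h).symm
      have e2 : ind (openConn d u : Set (BondConfig V)) (ζ \ cut Y ζ) = 0 :=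
        ind_of_not_mem fun h => hdu (eq_of_reachable_sdiff_cut hζ ζ u h)
      rw [e1, e2]; ring
  -- the `C_Y`-measurable part vanishes
  have hind : ∀ ζ : Set (Sym2 V), ind (avoidEv d Y) ζ = (if (d ∈ Y ∨ ∃ e ∈ setCl ζ Y, d ∈ e) then 0 else 1) := by
    intro ζ
    by_cases h : (d ∈ Y ∨ ∃ e ∈ setCl ζ Y, d ∈ e)
    · rw [if_pos h, ind_of_not_mem (fun h' => (mem_avoidEv_iff_notMem_span d Y ζ).1 h' h)]
    · rw [if_neg h, ind_of_mem ((mem_avoidEv_iff_notMem_span d Y ζ).2 h)]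
  have h3 : ∑ ζ, weight w ζ * (ind (avoidEv x Y) ζ * ((1 - ind (avoidEv d Y) ζ) *
      (g (openEdgeCluster ζ x) - wmeanOff w Y (fun β => g (openEdgeCluster β x)) ζ))) = 0 := by
    rw [← residual_orthogonal w hm x Y g (fun W => 1 - (if (d ∈ Y ∨ ∃ e ∈ W, d ∈ e) then 0 else 1))]
    exact Finset.sum_congr rfl fun ζ _ => by rw [hind]
  -- Step D for `ψ = 1{d↔u}` (read off `C_d`) and `ψ = 1`
  set ψu : Set (Sym2 V) → ℝ := fun W => if (u ∈ ({d} : Set V) ∨ ∃ e ∈ W, u ∈ e) then (1 : ℝ) else 0 with hψu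
  have hψ : ∀ ζ : Set (Sym2 V), ψu (openEdgeCluster ζ d) = ind (openConn d u : Set (BondConfig V)) ζ := by
    intro ζ
    have hiff : ζ ∈ (openConn d u : Set (BondConfig V)) ↔ (u ∈ ({d} : Set V) ∨ ∃ e ∈ setCl ζ {d}, u ∈ e) :=
      reachable_iff_setCl_singleton ζ d u
    rw [setCl_singleton] at hiff
    by_cases h : ζ ∈ (openConn d u : Set (BondConfig V))
    · rw [ind_of_mem h]; exact if_pos (hiff.1 h)
    · rw [ind_of_not_mem h]; exact if_neg (fun h' => h (hiff.2 h'))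
  have h4 := markov_at_decoy w hm x d Y g ψu
  have h4' : ∑ ζ, weight w ζ * (ind (avoidEv d (insert x Y)) ζ * (ind (openConn d u : Set (BondConfig V)) ζ *
        (ind (avoidEv x Y) ζ * (g (openEdgeCluster ζ x) - wmeanOff w Y (fun β => g (openEdgeCluster β x)) ζ)))) =
      -∑ ζ, weight w ζ * (ind (avoidEv d (insert x Y)) ζ * (ind (openConn d u : Set (BondConfig V)) ζ *
        ∑ η, weight w η * phiIntegrand x Y (openCluster ζ d) g η)) := by
    have l := Finset.sum_congr rfl (s₁ := (Finset.univ : Finset (Set (Sym2 V)))) fun ζ _ =>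
      (show weight w ζ * (ind (avoidEv d (insert x Y)) ζ * (ind (openConn d u : Set (BondConfig V)) ζ *
        (ind (avoidEv x Y) ζ * (g (openEdgeCluster ζ x) - wmeanOff w Y (fun β => g (openEdgeCluster β x)) ζ)))) =
        weight w ζ * (ind (avoidEv d (insert x Y)) ζ * (ψu (openEdgeCluster ζ d) *
        (ind (avoidEv x Y) ζ * (g (openEdgeCluster ζ x) - wmeanOff w Y (fun β => g (openEdgeCluster β x)) ζ)))) by
        rw [hψ ζ])
    have r := Finset.sum_congr rfl (s₁ := (Finset.univ : Finset (Set (Sym2 V)))) fun ζ _ =>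
      (show weight w ζ * (ind (avoidEv d (insert x Y)) ζ * (ind (openConn d u : Set (BondConfig V)) ζ *
        ∑ η, weight w η * phiIntegrand x Y (openCluster ζ d) g η)) =
        weight w ζ * (ind (avoidEv d (insert x Y)) ζ * (ψu (openEdgeCluster ζ d) *
        ∑ η, weight w η * phiIntegrand x Y (openCluster ζ d) g η)) by rw [hψ ζ])
    rw [l, r]; exact h4
  have h5 := markov_at_decoy w hm x d Y g (fun _ => (1 : ℝ))
  simp only [one_mul] at h5
  -- assemble
  have hsplit : ∀ ζ, weight w ζ * (ind (avoidEv x Y) ζ * ((g (openEdgeCluster ζ x) -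
        wmeanOff w Y (fun β => g (openEdgeCluster β x)) ζ) *
        (ind (avoidEv d {x}) (ζ \ cut Y ζ) * (a * ind (openConn d u : Set (BondConfig V)) (ζ \ cut Y ζ) - b)))) =
      a * (weight w ζ * (ind (avoidEv d (insert x Y)) ζ * (ind (openConn d u : Set (BondConfig V)) ζ *
        (ind (avoidEv x Y) ζ * (g (openEdgeCluster ζ x) - wmeanOff w Y (fun β => g (openEdgeCluster β x)) ζ))))) -
      b * (weight w ζ * (ind (avoidEv d (insert x Y)) ζ *
        (ind (avoidEv x Y) ζ * (g (openEdgeCluster ζ x) - wmeanOff w Y (fun β => g (openEdgeCluster β x)) ζ)))) -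
      b * (weight w ζ * (ind (avoidEv x Y) ζ * ((1 - ind (avoidEv d Y) ζ) *
        (g (openEdgeCluster ζ x) - wmeanOff w Y (fun β => g (openEdgeCluster β x)) ζ)))) := by
    intro ζ
    rw [h2 ζ, ← ind_avoidEv_mul d x Y ζ]
    ring
  rw [h1, Finset.sum_congr rfl (fun ζ _ => hsplit ζ), Finset.sum_sub_distrib, Finset.sum_sub_distrib,
    ← Finset.mul_sum, ← Finset.mul_sum, ← Finset.mul_sum, h3, mul_zero, sub_zero, h4', h5]
  ring

/-- **LEMMA U for one decoy (world-wise H/R̃ unfolding of the within-covariance of the level-1 form).**  Owner `x`, avoided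
set `Y`, decoy `d ∉ {x, o, v}`, observers `o, v`; `g` any functional of the open edge cluster of `x`; `a, b_o, b_v, α, β` any
reals; `D = {x↮Y}`, `E = {d↮{x}∪Y}`, `Φ(K) = Σ_η w I_K(η)`.  Then
`Σ_ω w 1_D Cov_{world}(g(C_x), α(a1{x↔o} − b_o1{x↔d}) − β(a1{x↔v} − b_v1{x↔d}))`
`= a Σ_ω w 1_D [α Cov_{world}(g(C_x),1{o↔{x,d}}) − β Cov_{world}(g(C_x),1{v↔{x,d}})] + α(aP_o − b_oP) − β(aP_v − b_vP)`,
`P_u = Σ_ζ w 1_E 1{d↔u} Φ(C_d)`, `P = Σ_ζ w 1_E Φ(C_d)`.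
(transcription of the cell memo prim-hp-8 PROOF-S5-ALL-R.md §3.3, k = 1) [folklore] -/
theorem unfold_one (w : Sym2 V → ℝ) (hm : ∑ ω, weight w ω = 1) (x d o v : V) (hdx : d ≠ x) (hdo : o ≠ d) (hdv : v ≠ d)
    (Y : Set V) (g : Set (Sym2 V) → ℝ) (a bo bv α β : ℝ) :
    ∑ ω, weight w ω * (ind (avoidEv x Y) ω * wcovOff w Y (fun ζ => g (openEdgeCluster ζ x))
        (fun ζ => α * (a * ind (openConn x o : Set (BondConfig V)) ζ - bo * ind (openConn x d : Set (BondConfig V)) ζ) -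
          β * (a * ind (openConn x v : Set (BondConfig V)) ζ - bv * ind (openConn x d : Set (BondConfig V)) ζ)) ω) =
      a * ∑ ω, weight w ω * (ind (avoidEv x Y) ω *
          (α * wcovOff w Y (fun ζ => g (openEdgeCluster ζ x)) (ind (openConn x o ∪ openConn d o : Set (BondConfig V))) ω -
            β * wcovOff w Y (fun ζ => g (openEdgeCluster ζ x)) (ind (openConn x v ∪ openConn d v : Set (BondConfig V))) ω)) +
        (α * (a * ∑ ζ, weight w ζ * (ind (avoidEv d (insert x Y)) ζ * (ind (openConn d o : Set (BondConfig V)) ζ *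
              ∑ η, weight w η * phiIntegrand x Y (openCluster ζ d) g η)) -
            bo * ∑ ζ, weight w ζ * (ind (avoidEv d (insert x Y)) ζ *
              ∑ η, weight w η * phiIntegrand x Y (openCluster ζ d) g η)) -
          β * (a * ∑ ζ, weight w ζ * (ind (avoidEv d (insert x Y)) ζ * (ind (openConn d v : Set (BondConfig V)) ζ *
              ∑ η, weight w η * phiIntegrand x Y (openCluster ζ d) g η)) -
            bv * ∑ ζ, weight w ζ * (ind (avoidEv d (insert x Y)) ζ *
              ∑ η, weight w η * phiIntegrand x Y (openCluster ζ d) g η))) := by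
  classical
  set G : Set (Sym2 V) → ℝ := fun β => g (openEdgeCluster β x) with hG
  -- the pointwise split of the two level-1 forms
  set Ru : V → ℝ → Set (Sym2 V) → ℝ := fun u b ζ =>
    ind (avoidEv d {x}) ζ * (a * ind (openConn d u : Set (BondConfig V)) ζ - b) with hRu
  have hsplit : (fun ζ => α * (a * ind (openConn x o : Set (BondConfig V)) ζ - bo * ind (openConn x d : Set (BondConfig V)) ζ) -
        β * (a * ind (openConn x v : Set (BondConfig V)) ζ - bv * ind (openConn x d : Set (BondConfig V)) ζ)) =
      fun ζ => α * (a * ind (openConn x o ∪ openConn d o : Set (BondConfig V)) ζ - bo - Ru o bo ζ) -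
        β * (a * ind (openConn x v ∪ openConn d v : Set (BondConfig V)) ζ - bv - Ru v bv ζ) := by
    funext ζ; simp only [hRu]; rw [level_one_split x d o a bo ζ, level_one_split x d v a bv ζ]
  have hcov : ∀ ω, wcovOff w Y G (fun ζ => α * (a * ind (openConn x o : Set (BondConfig V)) ζ -
        bo * ind (openConn x d : Set (BondConfig V)) ζ) -
          β * (a * ind (openConn x v : Set (BondConfig V)) ζ - bv * ind (openConn x d : Set (BondConfig V)) ζ)) ω =
      α * (a * wcovOff w Y G (ind (openConn x o ∪ openConn d o : Set (BondConfig V))) ω - wcovOff w Y G (Ru o bo) ω) -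
        β * (a * wcovOff w Y G (ind (openConn x v ∪ openConn d v : Set (BondConfig V))) ω - wcovOff w Y G (Ru v bv) ω) := by
    intro ω
    rw [hsplit, wcovOff_lin₂ w Y G, wcovOff_lin w hm Y G, wcovOff_lin w hm Y G]
  have ho := rtilde_term w hm x d o hdx hdo Y g a bo
  have hv := rtilde_term w hm x d v hdx hdv Y g a bv
  simp only [hG, hRu] at hcov ho hv ⊢
  have e : ∀ ω, weight w ω * (ind (avoidEv x Y) ω * wcovOff w Y (fun β => g (openEdgeCluster β x))
      (fun ζ => α * (a * ind (openConn x o : Set (BondConfig V)) ζ - bo * ind (openConn x d : Set (BondConfig V)) ζ) -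
        β * (a * ind (openConn x v : Set (BondConfig V)) ζ - bv * ind (openConn x d : Set (BondConfig V)) ζ)) ω) =
      a * (weight w ω * (ind (avoidEv x Y) ω *
        (α * wcovOff w Y (fun β => g (openEdgeCluster β x)) (ind (openConn x o ∪ openConn d o : Set (BondConfig V))) ω -
          β * wcovOff w Y (fun β => g (openEdgeCluster β x)) (ind (openConn x v ∪ openConn d v : Set (BondConfig V))) ω))) -
      α * (weight w ω * (ind (avoidEv x Y) ω * wcovOff w Y (fun β => g (openEdgeCluster β x))
        (fun ζ => ind (avoidEv d {x}) ζ * (a * ind (openConn d o : Set (BondConfig V)) ζ - bo)) ω)) +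
      β * (weight w ω * (ind (avoidEv x Y) ω * wcovOff w Y (fun β => g (openEdgeCluster β x))
        (fun ζ => ind (avoidEv d {x}) ζ * (a * ind (openConn d v : Set (BondConfig V)) ζ - bv)) ω)) := by
    intro ω; rw [hcov ω]; ring
  rw [Finset.sum_congr rfl (fun ω _ => e ω), Finset.sum_add_distrib, Finset.sum_sub_distrib, ← Finset.mul_sum,
    ← Finset.mul_sum, ← Finset.mul_sum, ho, hv]
  ring

end CSH

end Summit.CriticalPhenomena.PercolationContinuityZ3.Theorems
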